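import Literature.Combinatorics.StablePolynomials.UnivariateStabilityPreservers
import Mathlib.Algebra.Polynomial.Basis
import HarnessLib

/-!
# The master composition theorem for two variables (Borcea–Brändén II, Corollary 3.4 (a), case `n = 1`)

J. Borcea, P. Brändén, *The Lee–Yang and Pólya–Schur programs. II. Theory of stable polynomials and
applications*, Comm. Pure Appl. Math. 62 (2009) 1595–1631 (arXiv:0809.3087), §3:

> **Corollary 3.4.** Let `κ ∈ ℕⁿ` and `f, g ∈ ℂ[z_1,…,z_n,w_1,…,w_n]` be of the form
> `f(z,w) = Σ_{α ≤ κ} binom(κ,α) P_α(w) z^α`, `g(z,w) = Σ_{α ≤ κ} binom(κ,α) Q_α(z) w^α`.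
> (a) If `f` and `g` are `H_θ`-stable for some `0 ≤ θ < 2π`, then so is the polynomial
> `Σ_{α ≤ κ} binom(κ,α) P_α(w) Q_{κ-α}(z)` …
>
> *Proof.* Let `T : ℂ_β[z] → ℂ_κ[z]` and `S : ℂ_κ[z] → ℂ_γ[z]` be the linear operators whose algebraic symbols
> are `f`, respectively `g` … both `S` and `T` preserve stability, hence so does their composition `ST` whose
> symbol is precisely the polynomial in (a). Applying Theorem 3.1 again we conclude that this polynomial is
> stable unless it is of the form `A(z)B(w)` … by exchanging the roles of `f` and `g` we get that `B(w)`,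
> thus also `A(z)B(w)`, must be stable.

This file proves the case **`n = 1`, `θ = 0`** (upper half-plane) from Borcea–Brändén I, Theorem 1.1 for
`n = 1` (tree `boundedDegree_stabilityPreserver_iff`, `UnivariateStabilityPreservers.lean`), following the printed
proof: `slotOp κ Q` is `S` (`t^k ↦ Q_{κ-k}`, symbol `g`), `opOf β κ P (t^k ↦ t^k)` is `T` (symbol `f`,
`symbol_opOf`), the composition has symbol `h = Σ binom(κ,k) P_k(w) Q_{κ-k}(z)` (`comp_opOf`, `symbol_opOf`),
and the rank-one alternative gives `h = A(z)B(w)` (`univariateSymbol_of_rankOne`); exchanging `f` and `g`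
(the variable swap `rename (Equiv.swap 0 1)`) finishes the argument (`master_composition`). The conclusion is
stated as "stable **or identically zero**", as in the companion Theorem 3.3 (a) of the paper: for `κ = 1`,
`f = z`, `g = w` are stable while `h = P_0 Q_1 + P_1 Q_0 = 0`.

## Contents

* `compositionF`, `compositionG`, `composition` — `f`, `g`, `h` as polynomials in `z = X 0`, `w = X 1`.
* `opOf`, `opOf_X_pow`, `comp_opOf`, **`symbol_opOf`**; `slotOp`, `symbol_slotOp`;
  `univariateSymbol_of_rankOne`.
* `master_composition_pass` (one application of Thm. 1.1 to `ST`), **`master_composition`**.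

## References

* [BorceaBranden2009II] J. Borcea, P. Brändén, Comm. Pure Appl. Math. 62 (2009) 1595–1631, §3 Thm. 3.1,
  Thm. 3.3 (a), Cor. 3.4 (a) and its proof.
* [BorceaBranden2009] J. Borcea, P. Brändén, Invent. Math. 177 (2009) 541–569, §1.1 Thm. 1.1.
-/

noncomputable section

open MvPolynomial Finset

namespace Literature.Combinatorics.StablePolynomials

/-! ## §1 The three polynomials -/

section Polys

/-- **`f(z,w) = Σ_{k ≤ κ} binom(κ,k) P_k(w) z^k`** (`z = X 0`, `w = X 1`). [cite: BorceaBranden2009II, §3 Cor. 3.4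
("`f(z,w) = Σ_{α≤κ} binom(κ,α) P_α(w) z^α`")] -/
def compositionF (κ : ℕ) (P : ℕ → Polynomial ℂ) : MvPolynomial (Fin 2) ℂ :=
  ∑ k ∈ range (κ + 1), ((κ.choose k : ℕ) : ℂ) • ((Polynomial.X ^ k : Polynomial ℂ).toMvPolynomial 0 *
    (P k).toMvPolynomial 1)

/-- **`g(z,w) = Σ_{k ≤ κ} binom(κ,k) Q_k(z) w^k`.** [cite: BorceaBranden2009II, §3 Cor. 3.4
("`g(z,w) = Σ_{α≤κ} binom(κ,α) Q_α(z) w^α`")] -/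
def compositionG (κ : ℕ) (Q : ℕ → Polynomial ℂ) : MvPolynomial (Fin 2) ℂ :=
  ∑ k ∈ range (κ + 1), ((κ.choose k : ℕ) : ℂ) • ((Q k).toMvPolynomial 0 * X 1 ^ k)

/-- **`h(z,w) = Σ_{k ≤ κ} binom(κ,k) P_k(w) Q_{κ-k}(z)`** — the master composition of `f` and `g`.
[cite: BorceaBranden2009II, §3 Cor. 3.4 (a) ("`Σ_{α≤κ} binom(κ,α) P_α(w) Q_{κ-α}(z)`")] -/
def composition (κ : ℕ) (P Q : ℕ → Polynomial ℂ) : MvPolynomial (Fin 2) ℂ :=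
  ∑ k ∈ range (κ + 1), ((κ.choose k : ℕ) : ℂ) • ((Q (κ - k)).toMvPolynomial 0 * (P k).toMvPolynomial 1)

/-- Renaming by any map of variables preserves stability (`(rename e F)(z) = F(z ∘ e)`).
[cite: BorceaBranden2009II, §1 (definition of stability)] -/
theorem isUpperHalfPlaneStable_rename_of {σ τ : Type*} (e : σ → τ) {F : MvPolynomial σ ℂ}
    (hF : IsUpperHalfPlaneStable F) : IsUpperHalfPlaneStable (rename e F) := fun z hz => by
  rw [eval_rename]
  exact hF _ fun v => hz (e v)

/-- Exchanging `z` and `w` turns `g` into `f` (with `Q` for `P`). [cite: BorceaBranden2009II, §3 proof of Cor. 3.4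
("by exchanging the roles of `f` and `g`")] -/
theorem rename_swap_compositionG (κ : ℕ) (Q : ℕ → Polynomial ℂ) :
    rename (⇑(Equiv.swap (0 : Fin 2) 1)) (compositionG κ Q) = compositionF κ Q := by
  rw [compositionG, compositionF, map_sum]
  refine sum_congr rfl fun k _ => ?_
  rw [map_smul, _root_.map_mul, rename_toMvPolynomial, _root_.map_pow, rename_X, Equiv.swap_apply_left,
    Equiv.swap_apply_right, _root_.map_pow, Polynomial.toMvPolynomial_X, mul_comm]

/-- Exchanging `z` and `w` turns `f` into `g`. [cite: BorceaBranden2009II, §3 proof of Cor. 3.4] -/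
theorem rename_swap_compositionF (κ : ℕ) (P : ℕ → Polynomial ℂ) :
    rename (⇑(Equiv.swap (0 : Fin 2) 1)) (compositionF κ P) = compositionG κ P := by
  rw [compositionG, compositionF, map_sum]
  refine sum_congr rfl fun k _ => ?_
  rw [map_smul, _root_.map_mul, rename_toMvPolynomial, rename_toMvPolynomial, _root_.map_pow,
    Polynomial.toMvPolynomial_X, Equiv.swap_apply_left, Equiv.swap_apply_right, mul_comm]

/-- Exchanging `z` and `w` (and `P`, `Q`) preserves the composition `h`. [cite: BorceaBranden2009II, §3 proof of
Cor. 3.4 ("by exchanging the roles of `f` and `g`")] -/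
theorem rename_swap_composition (κ : ℕ) (P Q : ℕ → Polynomial ℂ) :
    rename (⇑(Equiv.swap (0 : Fin 2) 1)) (composition κ P Q) = composition κ Q P := by
  rw [composition, composition, map_sum, ← sum_range_reflect]
  refine sum_congr rfl fun k hk => ?_
  have hk' : k ≤ κ := Nat.lt_succ_iff.1 (mem_range.1 hk)
  rw [map_smul, _root_.map_mul, rename_toMvPolynomial, rename_toMvPolynomial, Equiv.swap_apply_left,
    Equiv.swap_apply_right, show κ + 1 - 1 - k = κ - k from by omega, Nat.sub_sub_self hk', Nat.choose_symm hk',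
    mul_comm]

end Polys

/-! ## §2 Operators with prescribed symbols -/

section Operators

/-- **The operator `T` with symbol `f`**, parametrised by the images `R_k` of the "slots" `k ≤ κ`:
`t^j ↦ binom(β,j)⁻¹ Σ_{k≤κ} binom(κ,k) [w^{β-j}]P_k · R_k` for `j ≤ β` (and `0` above degree `β`). With
`R_k = t^k` its symbol on `ℂ_β[t]` is `f`; composing with `S` replaces `R_k` by `S(t^k)`.
[cite: BorceaBranden2009II, §3 proof of Cor. 3.4 ("the linear operators whose algebraic symbols … are `f`,
respectively `g`")] -/
def opOf (β κ : ℕ) (P R : ℕ → Polynomial ℂ) : Polynomial ℂ →ₗ[ℂ] Polynomial ℂ :=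
  (Polynomial.basisMonomials ℂ).constr ℂ fun j =>
    if j ≤ β then
      (((β.choose j : ℕ) : ℂ))⁻¹ • ∑ k ∈ range (κ + 1), (((κ.choose k : ℕ) : ℂ) * (P k).coeff (β - j)) • R k
    else 0

/-- `opOf` on `t^j`, `j ≤ β`. [cite: BorceaBranden2009II, §3 proof of Cor. 3.4] -/
theorem opOf_X_pow {β κ : ℕ} {P R : ℕ → Polynomial ℂ} {j : ℕ} (hj : j ≤ β) :
    opOf β κ P R (Polynomial.X ^ j) =
      (((β.choose j : ℕ) : ℂ))⁻¹ • ∑ k ∈ range (κ + 1), (((κ.choose k : ℕ) : ℂ) * (P k).coeff (β - j)) • R k := by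
  rw [Polynomial.X_pow_eq_monomial, show (Polynomial.monomial j (1 : ℂ)) = Polynomial.basisMonomials ℂ j by
    rw [Polynomial.coe_basisMonomials], opOf, Module.Basis.constr_basis, if_pos hj]

/-- `opOf` on `t^j`, `j > β`. [cite: BorceaBranden2009II, §3 proof of Cor. 3.4] -/
theorem opOf_X_pow_of_lt {β κ : ℕ} {P R : ℕ → Polynomial ℂ} {j : ℕ} (hj : β < j) :
    opOf β κ P R (Polynomial.X ^ j) = 0 := by
  rw [Polynomial.X_pow_eq_monomial, show (Polynomial.monomial j (1 : ℂ)) = Polynomial.basisMonomials ℂ j by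
    rw [Polynomial.coe_basisMonomials], opOf, Module.Basis.constr_basis, if_neg (not_le.2 hj)]

/-- **Composition replaces the slots**: `S ∘ opOf(R) = opOf(S ∘ R)`. [cite: BorceaBranden2009II, §3 proof of
Cor. 3.4 ("their composition `ST`")] -/
theorem comp_opOf (β κ : ℕ) (P R : ℕ → Polynomial ℂ) (S : Polynomial ℂ →ₗ[ℂ] Polynomial ℂ) :
    S ∘ₗ opOf β κ P R = opOf β κ P fun k => S (R k) := by
  refine (Polynomial.basisMonomials ℂ).ext fun j => ?_
  rw [LinearMap.comp_apply, Polynomial.coe_basisMonomials]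
  show S (opOf β κ P R (Polynomial.monomial j 1)) = opOf β κ P (fun k => S (R k)) (Polynomial.monomial j 1)
  rw [← Polynomial.X_pow_eq_monomial]
  by_cases hj : j ≤ β
  · rw [opOf_X_pow hj, opOf_X_pow hj, map_smul, map_sum]
    simp only [map_smul]
  · rw [opOf_X_pow_of_lt (not_le.1 hj), opOf_X_pow_of_lt (not_le.1 hj), map_zero]

/-- Values of `opOf` have degree `≤ N` when all slots do. [cite: BorceaBranden2009II, §3 proof of Cor. 3.4
(`T : ℂ_β[z] → ℂ_κ[z]`)] -/
theorem natDegree_opOf_le {β κ N : ℕ} {P R : ℕ → Polynomial ℂ} (hR : ∀ k ∈ range (κ + 1), (R k).natDegree ≤ N)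
    (p : Polynomial ℂ) : (opOf β κ P R p).natDegree ≤ N := by
  have hj : ∀ j : ℕ, (opOf β κ P R (Polynomial.X ^ j)).natDegree ≤ N := by
    intro j
    by_cases h : j ≤ β
    · rw [opOf_X_pow h]
      exact (Polynomial.natDegree_smul_le _ _).trans (Polynomial.natDegree_sum_le_of_forall_le _ _ fun k hk =>
        (Polynomial.natDegree_smul_le _ _).trans (hR k hk))
    · rw [opOf_X_pow_of_lt (not_le.1 h), Polynomial.natDegree_zero]
      exact Nat.zero_le _
  rw [p.as_sum_range, map_sum]
  refine Polynomial.natDegree_sum_le_of_forall_le _ _ fun j _ => ?_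
  rw [← Polynomial.C_mul_X_pow_eq_monomial, ← Polynomial.smul_eq_C_mul, map_smul]
  exact (Polynomial.natDegree_smul_le _ _).trans (hj j)

/-- `ι_w(P) = Σ_{j ≤ β} [t^{β-j}]P · w^{β-j}` for `deg P ≤ β`. [folklore] -/
private theorem toMvPolynomial_eq_sum_reflect {β : ℕ} {p : Polynomial ℂ} (hp : p.natDegree ≤ β) (i : Fin 2) :
    p.toMvPolynomial i = ∑ j ∈ range (β + 1), p.coeff (β - j) • (X i ^ (β - j) : MvPolynomial (Fin 2) ℂ) := by
  conv_lhs => rw [p.as_sum_range' (β + 1) (Nat.lt_succ_of_le hp), map_sum]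
  rw [← sum_range_reflect]
  refine sum_congr rfl fun j _ => ?_
  rw [show β + 1 - 1 - j = β - j from by omega, ← Polynomial.C_mul_X_pow_eq_monomial, _root_.map_mul,
    Polynomial.toMvPolynomial_C, _root_.map_pow, Polynomial.toMvPolynomial_X, smul_eq_C_mul]

/-- **The symbol of `opOf`**: `G_{opOf(R)}(z,w) = Σ_{k≤κ} binom(κ,k) R_k(z) P_k(w)` on `ℂ_β[t]` when `deg P_k ≤ β`
— for `R_k = t^k` this is `f`, after composing with `S` (`R_k = Q_{κ-k}`) it is `h`.
[cite: BorceaBranden2009II, §3 proof of Cor. 3.4 ("whose symbol is precisely the polynomial in (a)")] -/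
theorem symbol_opOf {β κ : ℕ} {P : ℕ → Polynomial ℂ} (hP : ∀ k ∈ range (κ + 1), (P k).natDegree ≤ β)
    (R : ℕ → Polynomial ℂ) :
    univariateSymbol β (opOf β κ P R) =
      ∑ k ∈ range (κ + 1), ((κ.choose k : ℕ) : ℂ) • ((R k).toMvPolynomial 0 * (P k).toMvPolynomial 1) := by
  have h1 : ∀ j ∈ range (β + 1), ((β.choose j : ℕ) : ℂ) •
      ((opOf β κ P R (Polynomial.X ^ j)).toMvPolynomial 0 * (X 1 ^ (β - j) : MvPolynomial (Fin 2) ℂ)) =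
        ∑ k ∈ range (κ + 1), (((κ.choose k : ℕ) : ℂ) * (P k).coeff (β - j)) •
          ((R k).toMvPolynomial 0 * X 1 ^ (β - j)) := by
    intro j hj
    have hj' : j ≤ β := Nat.lt_succ_iff.1 (mem_range.1 hj)
    rw [opOf_X_pow hj', map_smul, map_sum, smul_mul_assoc, smul_smul,
      mul_inv_cancel₀ (Nat.cast_ne_zero.2 (Nat.choose_pos hj').ne'), one_smul, sum_mul]
    refine sum_congr rfl fun k _ => ?_
    rw [map_smul, smul_mul_assoc]
  rw [univariateSymbol, sum_congr rfl h1, sum_comm]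
  refine sum_congr rfl fun k hk => ?_
  rw [toMvPolynomial_eq_sum_reflect (hP k hk) 1, mul_sum, smul_sum]
  refine sum_congr rfl fun j _ => ?_
  rw [mul_smul_comm, smul_smul]

/-- **The operator `S` with symbol `g`**: `t^k ↦ Q_{κ-k}` (`k ≤ κ`). [cite: BorceaBranden2009II, §3 proof of Cor. 3.4] -/
def slotOp (κ : ℕ) (Q : ℕ → Polynomial ℂ) : Polynomial ℂ →ₗ[ℂ] Polynomial ℂ :=
  (Polynomial.basisMonomials ℂ).constr ℂ fun k => if k ≤ κ then Q (κ - k) else 0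

/-- `S(t^k) = Q_{κ-k}` for `k ≤ κ`. [cite: BorceaBranden2009II, §3 proof of Cor. 3.4] -/
theorem slotOp_X_pow {κ : ℕ} (Q : ℕ → Polynomial ℂ) {k : ℕ} (hk : k ≤ κ) :
    slotOp κ Q (Polynomial.X ^ k) = Q (κ - k) := by
  rw [Polynomial.X_pow_eq_monomial, show (Polynomial.monomial k (1 : ℂ)) = Polynomial.basisMonomials ℂ k by
    rw [Polynomial.coe_basisMonomials], slotOp, Module.Basis.constr_basis, if_pos hk]

/-- **The symbol of `S` on `ℂ_κ[t]` is `g`.** [cite: BorceaBranden2009II, §3 proof of Cor. 3.4] -/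
theorem symbol_slotOp (κ : ℕ) (Q : ℕ → Polynomial ℂ) : univariateSymbol κ (slotOp κ Q) = compositionG κ Q := by
  rw [univariateSymbol, compositionG, ← sum_range_reflect]
  refine sum_congr rfl fun k hk => ?_
  have hk' : k ≤ κ := Nat.lt_succ_iff.1 (mem_range.1 hk)
  rw [show κ + 1 - 1 - k = κ - k from by omega, slotOp_X_pow Q (Nat.sub_le κ k), Nat.sub_sub_self hk',
    Nat.choose_symm hk']

/-- **The symbol of a rank-one operator factorises**: if `L(t^j) = a_j A` for `j ≤ β` then
`G_L(z,w) = A(z) · B(w)` with `B = Σ_j binom(β,j) a_j w^{β-j}`. [cite: BorceaBranden2009II, §3 proof of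
Cor. 3.4 ("unless it is of the form `A(z)B(w)`")] -/
theorem univariateSymbol_of_rankOne {β : ℕ} {L : Polynomial ℂ →ₗ[ℂ] Polynomial ℂ} {a : ℕ → ℂ}
    {A : Polynomial ℂ} (h : ∀ j ∈ range (β + 1), L (Polynomial.X ^ j) = a j • A) :
    univariateSymbol β L = A.toMvPolynomial 0 *
      (∑ j ∈ range (β + 1), (((β.choose j : ℕ) : ℂ) * a j) • (Polynomial.X : Polynomial ℂ) ^ (β - j)).toMvPolynomial 1 := by
  rw [univariateSymbol, map_sum, mul_sum]
  refine sum_congr rfl fun j hj => ?_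
  rw [h j hj, map_smul, map_smul, _root_.map_pow, Polynomial.toMvPolynomial_X, smul_mul_assoc, smul_smul,
    mul_smul_comm]

end Operators

/-! ## §3 The master composition theorem (`n = 1`, upper half-plane) -/

section Main

/-- **One pass of the printed argument**: if `f` and `g` are stable (`κ ≥ 1`) then `h` is stable, or
`h = A(z)B(w)` with `A` stable (the rank-one alternative of Theorem 1.1 for `ST`).
[cite: BorceaBranden2009II, §3 proof of Cor. 3.4] [cite: BorceaBranden2009, §1.1 Thm. 1.1 (n = 1)] -/
theorem master_composition_pass {κ : ℕ} (hκ : 0 < κ) (P Q : ℕ → Polynomial ℂ)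
    (hf : IsUpperHalfPlaneStable (compositionF κ P)) (hg : IsUpperHalfPlaneStable (compositionG κ Q)) :
    IsUpperHalfPlaneStable (composition κ P Q) ∨
      ∃ A B : Polynomial ℂ, (∀ t : ℂ, 0 < t.im → A.eval t ≠ 0) ∧
        composition κ P Q = A.toMvPolynomial 0 * B.toMvPolynomial 1 := by
  -- a common degree bound `β ≥ 1` for the `P_k`
  set β : ℕ := max 1 ((range (κ + 1)).sup fun k => (P k).natDegree) with hβ
  have hβ1 : 0 < β := lt_of_lt_of_le Nat.one_pos (le_max_left _ _)
  have hP : ∀ k ∈ range (κ + 1), (P k).natDegree ≤ β := fun k hk =>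
    (Finset.le_sup (f := fun k => (P k).natDegree) hk).trans (le_max_right _ _)
  -- `S` preserves stability on `ℂ_κ[t]` (its symbol is `g`)
  have hS : ∀ p : Polynomial ℂ, p.natDegree ≤ κ → (∀ t : ℂ, 0 < t.im → p.eval t ≠ 0) →
      (∀ t : ℂ, 0 < t.im → (slotOp κ Q p).eval t ≠ 0) ∨ slotOp κ Q p = 0 :=
    (boundedDegree_stabilityPreserver_iff hκ (slotOp κ Q)).2 (Or.inr (by rw [symbol_slotOp]; exact hg))
  -- `T` preserves stability on `ℂ_β[t]` (its symbol is `f`)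
  set T := opOf β κ P fun k => Polynomial.X ^ k with hT
  have hTsymb : univariateSymbol β T = compositionF κ P := by
    rw [hT, symbol_opOf hP, compositionF]
  have hTpres : ∀ p : Polynomial ℂ, p.natDegree ≤ β → (∀ t : ℂ, 0 < t.im → p.eval t ≠ 0) →
      (∀ t : ℂ, 0 < t.im → (T p).eval t ≠ 0) ∨ T p = 0 :=
    (boundedDegree_stabilityPreserver_iff hβ1 T).2 (Or.inr (by rw [hTsymb]; exact hf))
  have hTdeg : ∀ p : Polynomial ℂ, (T p).natDegree ≤ κ := fun p =>
    natDegree_opOf_le (fun k hk => (Polynomial.natDegree_X_pow_le k).trans (Nat.lt_succ_iff.1 (mem_range.1 hk))) p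
  -- `ST` preserves stability on `ℂ_β[t]`
  have hST : ∀ p : Polynomial ℂ, p.natDegree ≤ β → (∀ t : ℂ, 0 < t.im → p.eval t ≠ 0) →
      (∀ t : ℂ, 0 < t.im → ((slotOp κ Q ∘ₗ T) p).eval t ≠ 0) ∨ (slotOp κ Q ∘ₗ T) p = 0 := by
    intro p hp hs
    rw [LinearMap.comp_apply]
    rcases hTpres p hp hs with h | h
    · exact hS _ (hTdeg p) h
    · exact Or.inr (by rw [h, map_zero])
  -- the symbol of `ST` is `h`
  have hSTsymb : univariateSymbol β (slotOp κ Q ∘ₗ T) = composition κ P Q := by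
    rw [hT, comp_opOf, symbol_opOf hP, composition]
    refine sum_congr rfl fun k hk => ?_
    rw [slotOp_X_pow Q (Nat.lt_succ_iff.1 (mem_range.1 hk))]
  -- Theorem 1.1 for `ST`
  rcases (boundedDegree_stabilityPreserver_iff hβ1 (slotOp κ Q ∘ₗ T)).1 hST with ⟨α, A, hA, hαA⟩ | hG
  · right
    refine ⟨A, ∑ j ∈ range (β + 1), (((β.choose j : ℕ) : ℂ) * α (Polynomial.X ^ j)) • Polynomial.X ^ (β - j),
      hA, ?_⟩
    rw [← hSTsymb]
    exact univariateSymbol_of_rankOne fun j hj =>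
      hαA _ ((Polynomial.natDegree_X_pow_le j).trans (Nat.lt_succ_iff.1 (mem_range.1 hj)))
  · left
    rwa [hSTsymb] at hG

/-- **The master composition theorem for two variables (Borcea–Brändén II, Cor. 3.4 (a), `n = 1`,
`H_θ = ℋ`).** If `f(z,w) = Σ_{k≤κ} binom(κ,k) P_k(w) z^k` and `g(z,w) = Σ_{k≤κ} binom(κ,k) Q_k(z) w^k` are
stable, then `h(z,w) = Σ_{k≤κ} binom(κ,k) P_k(w) Q_{κ-k}(z)` is stable or identically zero.
[cite: BorceaBranden2009II, §3 Cor. 3.4 (a) (case n = 1) and its proof; Thm. 3.3 (a) for the alternative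
"or identically zero"] -/
theorem master_composition {κ : ℕ} (P Q : ℕ → Polynomial ℂ)
    (hf : IsUpperHalfPlaneStable (compositionF κ P)) (hg : IsUpperHalfPlaneStable (compositionG κ Q)) :
    composition κ P Q = 0 ∨ IsUpperHalfPlaneStable (composition κ P Q) := by
  rcases Nat.eq_zero_or_pos κ with rfl | hκ
  · -- `κ = 0`: `h = Q_0(z) P_0(w) = g · f`
    right
    have hf' : compositionF 0 P = (P 0).toMvPolynomial 1 := by
      rw [compositionF, zero_add, range_one, sum_singleton, Nat.choose_self, Nat.cast_one, one_smul, pow_zero,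
        map_one, one_mul]
    have hg' : compositionG 0 Q = (Q 0).toMvPolynomial 0 := by
      rw [compositionG, zero_add, range_one, sum_singleton, Nat.choose_self, Nat.cast_one, one_smul, pow_zero,
        mul_one]
    have hh : composition 0 P Q = (Q 0).toMvPolynomial 0 * (P 0).toMvPolynomial 1 := by
      rw [composition, zero_add, range_one, sum_singleton, Nat.choose_self, Nat.cast_one, one_smul, Nat.sub_zero]
    rw [hh]
    rw [hf'] at hf
    rw [hg'] at hg
    exact hg.mul hf
  · -- `κ ≥ 1`: two passes, the second with `z ↔ w`, `f ↔ g`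
    have hf' : IsUpperHalfPlaneStable (compositionF κ Q) := by
      rw [← rename_swap_compositionG]
      exact isUpperHalfPlaneStable_rename_of _ hg
    have hg' : IsUpperHalfPlaneStable (compositionG κ P) := by
      rw [← rename_swap_compositionF]
      exact isUpperHalfPlaneStable_rename_of _ hf
    rcases master_composition_pass hκ P Q hf hg with h1 | ⟨A, B, hA, hAB⟩
    · exact Or.inr h1
    rcases master_composition_pass hκ Q P hf' hg' with h2 | ⟨A', B', hA', hAB'⟩
    · refine Or.inr ?_
      rw [← rename_swap_composition] at h2
      have h3 := isUpperHalfPlaneStable_rename_of (⇑(Equiv.swap (0 : Fin 2) 1)) h2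
      rwa [rename_rename, show (⇑(Equiv.swap (0 : Fin 2) 1) ∘ ⇑(Equiv.swap (0 : Fin 2) 1)) = id from
        funext fun i => Equiv.swap_apply_self _ _ _, rename_id] at h3
    -- both passes give product forms: `A(z)B(w) = B'(z)A'(w)`
    have hprod : A.toMvPolynomial 0 * B.toMvPolynomial 1 =
        (B'.toMvPolynomial 0 * A'.toMvPolynomial 1 : MvPolynomial (Fin 2) ℂ) := by
      rw [← hAB, ← rename_swap_composition κ Q P, hAB', _root_.map_mul, rename_toMvPolynomial,
        rename_toMvPolynomial, Equiv.swap_apply_left, Equiv.swap_apply_right, mul_comm]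
    by_cases hB : B = 0
    · left
      rw [hAB, hB, map_zero, mul_zero]
    · right
      -- specialise `z = i`: `A(i) B = B'(i) A'`
      have hAI : A.eval Complex.I ≠ 0 := hA _ (by simp)
      have hspec : Polynomial.C (A.eval Complex.I) * B = Polynomial.C (B'.eval Complex.I) * A' := by
        have h := congrArg (MvPolynomial.aeval (![Polynomial.C Complex.I, Polynomial.X] : Fin 2 → Polynomial ℂ))
          hprod
        simp only [_root_.map_mul, aeval_toMvPolynomial, Matrix.cons_val_zero, Matrix.cons_val_one,
          Polynomial.aeval_X_left_apply] at h
        rwa [← Polynomial.algebraMap_eq, Polynomial.aeval_algebraMap_apply_eq_algebraMap_eval,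
          Polynomial.aeval_algebraMap_apply_eq_algebraMap_eval, Polynomial.algebraMap_eq] at h
      have hB'I : B'.eval Complex.I ≠ 0 := by
        intro h0
        rw [h0, map_zero, zero_mul, mul_eq_zero] at hspec
        rcases hspec with h | h
        · exact hAI (Polynomial.C_eq_zero.1 h)
        · exact hB h
      have hBeq : B = Polynomial.C (B'.eval Complex.I / A.eval Complex.I) * A' := by
        rw [div_eq_mul_inv, mul_comm (B'.eval Complex.I), Polynomial.C_mul, mul_assoc, ← hspec, ← mul_assoc,
          ← Polynomial.C_mul, inv_mul_cancel₀ hAI, Polynomial.C_1, one_mul]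
      have hBs : ∀ t : ℂ, 0 < t.im → B.eval t ≠ 0 := fun t ht => by
        rw [hBeq, Polynomial.eval_mul, Polynomial.eval_C]
        exact mul_ne_zero (div_ne_zero hB'I hAI) (hA' t ht)
      rw [hAB]
      exact ((isUpperHalfPlaneStable_toMvPolynomial_iff 0 A).2 hA).mul
        ((isUpperHalfPlaneStable_toMvPolynomial_iff 1 B).2 hBs)

end Main

end Literature.Combinatorics.StablePolynomials

end
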